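import Summits.ValiantsHypothesis.ValiantsHypothesis.Theorems.LacunarySymmetroidMatrixDescartesCensusTable
import Summits.ValiantsHypothesis.ValiantsHypothesis.Theorems.KPlusLogSqLawTropicalSymmetricThreeKRail
import Summits.ValiantsHypothesis.ValiantsHypothesis.Theorems.KPlusLogSqLawSymmetricDesignGraft
import Summits.ValiantsHypothesis.ValiantsHypothesis.Theorems.LacunarySymmetroidMatrixDescartesCensusExtremalVsCrux

/-!
# Route «KPlusLogSqLaw» — the RAIL LAW at `m = 3` as NAMED statements: `ζ₊sym(3,K) ≥ 6K − 9 = P(3,K)` for every `K ≥ 3`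
# (cell conjecture, theory-2 g19), its tropical (design) form, and the kernel evidence `K ≤ 10`

HONEST FRAMING.  Helper file (seat typer (g11), cell `pub-symmetroid`, 2026-08-27; `--supports` the `WeakLifting` item
stmt-ValiantsHypothesis-19561 as a helper, no closure claim).  Two NAMED `Prop`s, NEITHER ASSERTED — the cell's located RAIL LAW of record
(lead R1597 (A): «T^single_sym(3,K; rail) = 6K − 9 = P(3,K)», theory-2 g19, LAW-VS-KERNEL-TROPICAL-t2g19.md §3b: ceiling one code for `K ≤ 8`,
floor two codes and KERNEL for `K = 5…10` by `KPlusLogSqLaw.symmDesign_three_*_rail_attained`) written in the tree's row currencies: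
* `TropRailFloorThree` — for every `K ≥ 3` there is a SYMMETRIC `(3,K)` dominance design (`|ε| ≤ 1`) with `6K − 8` uniquely dominant terms at
  strictly increasing integer slopes and `6K − 9` sign alternations (stated in the exact row shape of the tree's design theorems);
* `RailFloorThree` — for every `K ≥ 3`, `ζ₊sym(3,K) ≥ 6K − 9`, i.e. `¬ PosRootLawAt 3 K (6K − 10)` (`6K − 9 = P(3,K)`, the parameter count of the
  symmetric `(3,K)` format);
and THEOREMS: `railFloorThree_of_trop` (design form ⇒ real form, ONE application of the symmetric designs graft
`TropicalCensus.not_posRootLawAt_of_symmDesign_row`); **`railFloorThree_upto_ten : ∀ K, 3 ≤ K → K ≤ 10 → ¬ PosRootLawAt 3 K (6K − 10)`** — the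
kernel EVIDENCE (census rows `(3,3) = 9`, `(3,4) ≥ 18`, `(3,5) ≥ 27`, `(3,6) ≥ 30`, `(3,7) ≥ 35` of `…CensusTable`, and the rail rows `(3,8) ≥ 39`,
`(3,9) ≥ 45`, `(3,10) ≥ 51` of `…TropicalSymmetricThreeKRail`); `tropRailFloorThree_five_to_ten` (the design form for `5 ≤ K ≤ 10`, verbatim the
six rail theorems); `railFloorThree_iff_tail` (the conjecture is equivalent to its `K ≥ 11` tail).  A general-`K` proof needs closed-form heights
for theory-2's uniform rail word (scoping: HOME/typer/g11/rail/).  Unconditional kernel floors at `m = 3` today: `3K + 21` for `K ≥ 10`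
(`KPlusLogSqLaw.not_posRootLawAt_three_rail_ray`) and `4K − 5` (`TropicalCensus.SymTwoK.not_posRootLawAt_chain_border`).  Nothing here is a
census numeral beyond those rows; nothing on DoorA26 / DoorA34 (`PosRootLawAt 2 6 19` / `PosRootLawAt 3 4 18`, OPEN, typed, never asserted), on
`TropicalB` / `WeakLifting`, on `MatrixDescartes` (stmt-ValiantsHypothesis-18050) or on `VP ≠ VNP`; a lower census bound refutes no law of record.
[candidate of the cell; no citation exists]
NOT SHARP AS A TROPICAL VALUE (desk R1713, 2026-08-27): the rail count `6K − 9` is exceeded by GENERAL (not necessarily symmetric) `(3,K)` designs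
from `K = 10` on — `KPlusLogSqLaw.not_tropRootLawAt_three_ten_53 : ¬ TropRootLawAt 3 10 53` (val-sym-trop-p3 g5, `…TropicalBThreeRowTen`:
`T(3,10) ≥ 54 > 51`; located reading `T(3,K) ≥ 9K − O(1)`); so the two names below are FLOORS, not conjectured equalities, and whether the
SYMMETRIC single-term row / `ζ₊sym(3,K)` also exceed `6K − 9` is open (R1713 (iii)).
-/

-- `Summit.ValiantsHypothesis.ValiantsHypothesis.…` is the tree's mandated single-conjunct layout (Sub = Summit).
set_option linter.dupNamespace false
set_option autoImplicit false

namespace Summit.ValiantsHypothesis.ValiantsHypothesis.Theorems.KPlusLogSqLaw.RailLaw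

open Summit.ValiantsHypothesis.ValiantsHypothesis.Theorems.MatrixDescartes.Negative
open Summit.ValiantsHypothesis.ValiantsHypothesis.Theorems.LacunarySymmetroidMatrixDescartes
open Summit.ValiantsHypothesis.ValiantsHypothesis.Theorems.LacunarySymmetroidMatrixDescartes.TropicalCensus

/-- The design-row shape used throughout the symmetric tropical files: a SYMMETRIC `(3,K)` design (`v`, `ε` symmetric, `|ε| ≤ 1`) with `B + 1`
uniquely dominant terms at strictly increasing integer slopes and `B` sign alternations. [definition of the cell] -/
def SymmDesignRowThree (K B : ℕ) : Prop :=
  ∃ (d : Fin K → ℕ) (v ε : Fin 3 → Fin 3 → Fin K → ℤ), (∀ i j l, v i j l = v j i l) ∧ (∀ i j l, ε i j l = ε j i l) ∧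
    (∀ i j l, (ε i j l).natAbs ≤ 1) ∧
    ∃ (θ : Fin (B + 1) → ℤ) (p : Fin (B + 1) → Equiv.Perm (Fin 3) × (Fin 3 → Fin K)), StrictMono θ ∧
      (∀ k, IsDominant d v ε (θ k) (p k)) ∧ ∀ k : Fin B, termSign ε (p k.castSucc) * termSign ε (p k.succ) < 0

/-- **The tropical RAIL LAW at `m = 3` (design form; cell conjecture, theory-2 g19): for every `K ≥ 3` a SYMMETRIC `(3,K)` design with
`6K − 9 = P(3,K)` alternations exists.**  NOT asserted; kernel for `K = 5…10` on the rail `(0,1,K,…,K^{K−1})` (`tropRailFloorThree_five_to_ten`).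
A FLOOR, not an equality: general designs reach `54 > 51` at `K = 10` (`KPlusLogSqLaw.not_tropRootLawAt_three_ten_53`, R1713).
[candidate of the cell; no citation exists] -/
def TropRailFloorThree : Prop := ∀ K : ℕ, 3 ≤ K → SymmDesignRowThree K (6 * K - 9)

/-- **The RAIL LAW at `m = 3` (real floor form; cell conjecture): `ζ₊sym(3,K) ≥ 6K − 9 = P(3,K)` for every `K ≥ 3`** —
`¬ PosRootLawAt 3 K (6K − 10)`.  NOT asserted; kernel for `K ≤ 10` (`railFloorThree_upto_ten`).  A FLOOR statement; not claimed sharp (R1713).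
[candidate of the cell; no citation exists] -/
def RailFloorThree : Prop := ∀ K : ℕ, 3 ≤ K → ¬ PosRootLawAt 3 K (6 * K - 10)

/-- **Design form ⇒ real form**, by the symmetric designs graft at `j = 0` (`not_posRootLawAt_of_symmDesign_row`: symmetric patchworking at the
same format). [folklore] -/
theorem railFloorThree_of_trop (h : TropRailFloorThree) : RailFloorThree := by
  intro K hK
  have hrow := not_posRootLawAt_of_symmDesign_row (m := 3) (K := K) (B := 6 * K - 9) (by omega) (h K hK)
  rwa [show 6 * K - 9 - 1 = 6 * K - 10 by omega] at hrow

/-- a single design row gives the real row at that format. [folklore] -/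
theorem not_posRootLawAt_of_row {K : ℕ} (hK : 3 ≤ K) (h : SymmDesignRowThree K (6 * K - 9)) : ¬ PosRootLawAt 3 K (6 * K - 10) := by
  have hrow := not_posRootLawAt_of_symmDesign_row (m := 3) (K := K) (B := 6 * K - 9) (by omega) h
  rwa [show 6 * K - 9 - 1 = 6 * K - 10 by omega] at hrow

/-- **The design form holds for `5 ≤ K ≤ 10`** — verbatim the six rail theorems of `…TropicalSymmetricThreeKRail` (theory-2 g19 designs,
`decide`-checked). [folklore] -/
theorem tropRailFloorThree_five_to_ten : ∀ K : ℕ, 5 ≤ K → K ≤ 10 → SymmDesignRowThree K (6 * K - 9) := by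
  intro K h5 h10
  interval_cases K
  · exact symmDesign_three_five_rail_attained
  · exact symmDesign_three_six_rail_attained
  · exact symmDesign_three_seven_rail_attained
  · exact symmDesign_three_eight_rail_attained
  · exact symmDesign_three_nine_rail_attained
  · exact symmDesign_three_ten_rail_attained

/-- **Kernel evidence: the real rail floor holds for every `3 ≤ K ≤ 10`** — `(3,3) = 9` (`Census.row_3_3`), `(3,4) ≥ 18` (`Census.bounds_3_4'`),
`(3,5) ≥ 27` (`Census.bounds_3_5''`), `(3,6) ≥ 30` (`Census.bounds_3_6'`), `(3,7) ≥ 35` (`Census.bounds_3_7'`) — each at least `6K − 9` — and the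
rail rows `(3,8) ≥ 39`, `(3,9) ≥ 45`, `(3,10) ≥ 51`. [folklore] -/
theorem railFloorThree_upto_ten : ∀ K : ℕ, 3 ≤ K → K ≤ 10 → ¬ PosRootLawAt 3 K (6 * K - 10) := by
  intro K h3 h10
  interval_cases K
  · exact Census.row_3_3.2
  · exact fun h => Census.bounds_3_4'.1 (Census.posRootLawAt_mono (by norm_num) h)
  · exact fun h => Census.bounds_3_5''.1 (Census.posRootLawAt_mono (by norm_num) h)
  · exact fun h => Census.bounds_3_6'.1 (Census.posRootLawAt_mono (by norm_num) h)
  · exact fun h => Census.bounds_3_7'.1 (Census.posRootLawAt_mono (by norm_num) h)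
  · exact not_posRootLawAt_three_eight_38
  · exact not_posRootLawAt_three_nine_44
  · exact not_posRootLawAt_three_ten_50

/-- **The conjecture reduces to its tail**: `RailFloorThree ↔ ∀ K ≥ 11, ¬ PosRootLawAt 3 K (6K − 10)`. [folklore] -/
theorem railFloorThree_iff_tail : RailFloorThree ↔ ∀ K : ℕ, 11 ≤ K → ¬ PosRootLawAt 3 K (6 * K - 10) := by
  constructor
  · exact fun h K hK => h K (by omega)
  · intro h K hK
    by_cases h10 : K ≤ 10
    · exact railFloorThree_upto_ten K hK h10
    · exact h K (by omega)

end Summit.ValiantsHypothesis.ValiantsHypothesis.Theorems.KPlusLogSqLaw.RailLaw
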